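import Summits.ValiantsHypothesis.ValiantsHypothesis.Theorems.PolyaContinuedSignedCoverLittleBijection
import Mathlib.GroupTheory.Perm.Cycle.Basic
import Mathlib.GroupTheory.Perm.Cycle.Factors
import HarnessLib

/-!
# Route PolyaContinued — support item `SignedCoverLittle` (stmt-ValiantsHypothesis-7426):
# H-side transfer lemmas (§2 (S2)+(F1) of the paper proof `proof-LabelTransfer.md`)

Sequel to `PolyaContinuedSignedCoverLittleBijection.lean`. Setting: `H, E ⊆ Fin n × Fin n`, a cell
relabelling `φ`, and the LABEL IDENTITY `Σ_{σ ∈ PM(H)} Π_i X (φ (i, σ i)) = PM_E` (`hid`), under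
which `σ ↦ π` with `e_φ(σ) = m_π` (label exponent = matching exponent) is a bijection
`PM(H) → PM(E)` mapping the cells of `σ` bijectively (through `φ`) onto the cells of `π`
(`exists_perm_of_labelIdentity`, `labelExponent_injective_of_labelIdentity`,
`exists_preimage_of_labelIdentity`, `label_mem_of_eq`, `label_injective_of_eq`). This file transfers
COMBINATORIAL STRUCTURE from the perfect matchings of `E` back to those of `H`:

* `card_filter_isPerfectMatching_eq` (B1) — `H` and `E` have the same number of perfect matchings;
* `exists_rowPerm_of_labelExponent_eq` (B2) — for `e_φ(σ) = m_π` there is a permutation `b` of the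
  rows with `φ (i, σ i) = (b i, π (b i))`: the labels of the cells of `σ` are the cells of `π` read
  through a row bijection; in normal form (`φ (i, i) = (i, i)`) `b` fixes the fixed rows of `σ`
  (`exists_rowPerm_of_labelExponent_eq_of_normal`), so the arcs of the dicircuit `σ` carry, once
  each, the arcs of `π` and the loops `(a, a)`, `a ∈ supp σ ∖ supp π`;
* `apply_eq_self_of_labelExponent_eq` (B3) — in normal form, fixed rows of `σ` are fixed rows of
  `π` (`supp π ⊆ supp σ`, `support_subset_of_labelExponent_eq`);
* `card_filter_apply_eq_le` (B4) — `σ, σ'` agree on at most as many rows as `π, π'` do;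
* `eq_one_or_eq_of_isCycle` (B5) — a permutation moving every point either nowhere or along a
  given cyclic permutation `ρ` is `1` or `ρ`;
* `isCycle_inv_mul_of_labelIdentity` (B6) — **adjacency pull-back**: if `π⁻¹ π'` is a single
  cycle then so is `σ⁻¹ σ'` (switching one cycle of `σ⁻¹ σ'` would be a third perfect matching of
  `H` whose image has all its cells among those of `π, π'`, hence equals `π` or `π'`);
* `image_apply_mem₂`, `image_apply_mem₃` (B7) — **closure**: if every cell of `τ` is a cell of
  `σ` or `σ'` (or `σ''`), every cell of its image is a cell of `π` or `π'` (or `π''`);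
* step (F1) of the proof (the dicircuits of `D(H)` in normal form) is the sequel
  `PolyaContinuedSignedCoverLittleTransferCircuits.lean`.

All statements are over `ℂ` and `Fin n`, matching the route; no new definitions.
-/

noncomputable section

namespace Summit.ValiantsHypothesis.PolyaContinued

open MvPolynomial Finset Literature.Combinatorics.SimpleGraph Equiv

variable {n : ℕ}

/-- `σ (σ⁻¹ x) = x`. [folklore] -/
private theorem perm_apply_inv_self (σ : Perm (Fin n)) (x : Fin n) : σ (σ⁻¹ x) = x :=
  σ.apply_symm_apply x

/-- `σ⁻¹ (σ x) = x`. [folklore] -/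
private theorem perm_inv_apply_self (σ : Perm (Fin n)) (x : Fin n) : σ⁻¹ (σ x) = x :=
  σ.symm_apply_apply x

/-! ### (B5) Permutations squeezed between the identity and a cycle -/

/-- A permutation `θ` with `θ a ∈ {a, ρ a}` for every `a`, where `ρ` is a cyclic permutation, is
the identity or `ρ` itself: once `θ` follows `ρ` at one point of the circuit, injectivity forces it
to follow `ρ` all the way round. [folklore] -/
theorem eq_one_or_eq_of_isCycle {ρ θ : Perm (Fin n)} (hρ : ρ.IsCycle)
    (h : ∀ a, θ a = a ∨ θ a = ρ a) : θ = 1 ∨ θ = ρ := by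
  by_cases hfix : ∀ a, θ a = a
  · exact Or.inl (Equiv.ext fun a => by simpa using hfix a)
  · right
    obtain ⟨a₀, ha₀⟩ := not_forall.mp hfix
    have hθa₀ : θ a₀ = ρ a₀ := (h a₀).resolve_left ha₀
    have hρa₀ : ρ a₀ ≠ a₀ := fun e => ha₀ (hθa₀.trans e)
    -- `θ` follows `ρ` along the whole circuit through `a₀`
    have key : ∀ k : ℕ, θ ((ρ ^ k) a₀) = ρ ((ρ ^ k) a₀) := by
      intro k
      induction k with
      | zero => simpa using hθa₀
      | succ k ih =>
        set b := (ρ ^ k) a₀ with hb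
        have hstep : (ρ ^ (k + 1)) a₀ = ρ b := by rw [pow_succ', Perm.mul_apply]
        rw [hstep]
        rcases h (ρ b) with h1 | h1
        · -- `θ (ρ b) = ρ b = θ b`: then `ρ b = b`, and both options agree
          have hbb : ρ b = b := θ.injective (h1.trans ih.symm)
          rw [h1, hbb, hbb]
        · exact h1
    refine Equiv.ext fun a => ?_
    by_cases hρa : ρ a = a
    · rcases h a with h1 | h1
      · rw [h1, hρa]
      · exact h1
    · obtain ⟨k, hk⟩ := hρ.exists_pow_eq hρa₀ hρa
      rw [← hk]
      exact key k

/-! ### (B2), (B3) The labels of a perfect matching, read through a row bijection -/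

/-- **Row bijection.** If `e_φ(σ) = m_π` then the labels of the cells of `σ` are the cells of `π`
read through a permutation `b` of the rows: `φ (i, σ i) = (b i, π (b i))`. [folklore] -/
theorem exists_rowPerm_of_labelExponent_eq {φ : Fin n × Fin n → Fin n × Fin n}
    {σ π : Perm (Fin n)}
    (h : (∑ i, Finsupp.single (φ (i, σ i)) 1 : (Fin n × Fin n) →₀ ℕ) = matchingExponent π) :
    ∃ b : Perm (Fin n), ∀ i, φ (i, σ i) = (b i, π (b i)) := by
  classical
  let f : Fin n → Fin n := fun i => (φ (i, σ i)).1
  have hf : ∀ i, φ (i, σ i) = (f i, π (f i)) := fun i =>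
    Prod.ext rfl (label_mem_of_eq h i).symm
  have hinj : Function.Injective f := by
    intro i j hij
    have : φ (i, σ i) = φ (j, σ j) := by rw [hf i, hf j, hij]
    exact label_injective_of_eq h this
  exact ⟨Equiv.ofBijective f (Finite.injective_iff_bijective.mp hinj), fun i => hf i⟩

/-- Row bijection in normal form: if moreover `φ (i, i) = (i, i)` for all `i`, the row bijection
fixes every fixed row of `σ`. [folklore] -/
theorem exists_rowPerm_of_labelExponent_eq_of_normal {φ : Fin n × Fin n → Fin n × Fin n}
    (hφ : ∀ i, φ (i, i) = (i, i)) {σ π : Perm (Fin n)}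
    (h : (∑ i, Finsupp.single (φ (i, σ i)) 1 : (Fin n × Fin n) →₀ ℕ) = matchingExponent π) :
    ∃ b : Perm (Fin n), (∀ i, φ (i, σ i) = (b i, π (b i))) ∧ ∀ i, σ i = i → b i = i := by
  obtain ⟨b, hb⟩ := exists_rowPerm_of_labelExponent_eq h
  refine ⟨b, hb, fun i hi => ?_⟩
  have := hb i
  rw [hi, hφ] at this
  exact (Prod.ext_iff.1 this).1.symm

/-- **Fixed rows transfer** (normal form): if `φ (i, i) = (i, i)` and `e_φ(σ) = m_π`, then every
fixed row of `σ` is a fixed row of `π` — the label of the diagonal cell `(i, i)` of `σ` is the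
diagonal cell `(i, i)`, which must be a cell of `π`. [folklore] -/
theorem apply_eq_self_of_labelExponent_eq {φ : Fin n × Fin n → Fin n × Fin n}
    (hφ : ∀ i, φ (i, i) = (i, i)) {σ π : Perm (Fin n)}
    (h : (∑ i, Finsupp.single (φ (i, σ i)) 1 : (Fin n × Fin n) →₀ ℕ) = matchingExponent π)
    {i : Fin n} (hi : σ i = i) : π i = i := by
  have := label_mem_of_eq h i
  rw [hi, hφ] at this
  exact this

/-- Support form of the preceding: `supp π ⊆ supp σ`. [folklore] -/
theorem support_subset_of_labelExponent_eq {φ : Fin n × Fin n → Fin n × Fin n}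
    (hφ : ∀ i, φ (i, i) = (i, i)) {σ π : Perm (Fin n)}
    (h : (∑ i, Finsupp.single (φ (i, σ i)) 1 : (Fin n × Fin n) →₀ ℕ) = matchingExponent π) :
    π.support ⊆ σ.support := by
  intro i hi
  rw [Perm.mem_support] at hi ⊢
  exact fun hσ => hi (apply_eq_self_of_labelExponent_eq hφ h hσ)

/-! ### (B4) Common cells -/

/-- **Common cells do not multiply.** If `e_φ(σ) = m_π` and `e_φ(σ') = m_{π'}` then `σ` and `σ'`
agree on at most as many rows as `π` and `π'` do: a common cell of `σ, σ'` is labelled by a common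
cell of `π, π'`, injectively. [folklore] -/
theorem card_filter_apply_eq_le {φ : Fin n × Fin n → Fin n × Fin n} {σ σ' π π' : Perm (Fin n)}
    (h : (∑ i, Finsupp.single (φ (i, σ i)) 1 : (Fin n × Fin n) →₀ ℕ) = matchingExponent π)
    (h' : (∑ i, Finsupp.single (φ (i, σ' i)) 1 : (Fin n × Fin n) →₀ ℕ) = matchingExponent π') :
    (Finset.univ.filter fun i => σ i = σ' i).card ≤
      (Finset.univ.filter fun a => π a = π' a).card := by
  classical
  obtain ⟨b, hb⟩ := exists_rowPerm_of_labelExponent_eq h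
  obtain ⟨b', hb'⟩ := exists_rowPerm_of_labelExponent_eq h'
  refine Finset.card_le_card_of_injOn b (fun i hi => ?_) (fun i _ j _ hij => b.injective hij)
  rw [Finset.mem_coe, Finset.mem_filter] at hi
  have key : (b i, π (b i)) = (b' i, π' (b' i)) := by rw [← hb i, ← hb' i, hi.2]
  obtain ⟨h1, h2⟩ := Prod.ext_iff.1 key
  simp only at h1 h2
  rw [Finset.mem_coe, Finset.mem_filter]
  exact ⟨Finset.mem_univ _, by rw [h2, h1]⟩

/-! ### (B7) Closure: images of sub-unions -/

/-- **Closure under unions, two matchings.** If every cell of `τ` is a cell of `σ` or of `σ'`, then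
every cell of the image of `τ` is a cell of the image of `σ` or of `σ'`. [folklore] -/
theorem image_apply_mem₂ {φ : Fin n × Fin n → Fin n × Fin n} {τ σ σ' ψ π π' : Perm (Fin n)}
    (hτ : (∑ i, Finsupp.single (φ (i, τ i)) 1 : (Fin n × Fin n) →₀ ℕ) = matchingExponent ψ)
    (h : (∑ i, Finsupp.single (φ (i, σ i)) 1 : (Fin n × Fin n) →₀ ℕ) = matchingExponent π)
    (h' : (∑ i, Finsupp.single (φ (i, σ' i)) 1 : (Fin n × Fin n) →₀ ℕ) = matchingExponent π')
    (hcells : ∀ i, τ i = σ i ∨ τ i = σ' i) (a : Fin n) : ψ a = π a ∨ ψ a = π' a := by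
  obtain ⟨i, hi⟩ := exists_label_eq_of_eq hτ a
  rcases hcells i with hc | hc
  · left
    have hm := label_mem_of_eq h i
    rw [← hc, hi] at hm
    exact hm.symm
  · right
    have hm := label_mem_of_eq h' i
    rw [← hc, hi] at hm
    exact hm.symm

/-- **Closure under unions, three matchings.** [folklore] -/
theorem image_apply_mem₃ {φ : Fin n × Fin n → Fin n × Fin n}
    {τ σ σ' σ'' ψ π π' π'' : Perm (Fin n)}
    (hτ : (∑ i, Finsupp.single (φ (i, τ i)) 1 : (Fin n × Fin n) →₀ ℕ) = matchingExponent ψ)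
    (h : (∑ i, Finsupp.single (φ (i, σ i)) 1 : (Fin n × Fin n) →₀ ℕ) = matchingExponent π)
    (h' : (∑ i, Finsupp.single (φ (i, σ' i)) 1 : (Fin n × Fin n) →₀ ℕ) = matchingExponent π')
    (h'' : (∑ i, Finsupp.single (φ (i, σ'' i)) 1 : (Fin n × Fin n) →₀ ℕ) = matchingExponent π'')
    (hcells : ∀ i, τ i = σ i ∨ τ i = σ' i ∨ τ i = σ'' i) (a : Fin n) :
    ψ a = π a ∨ ψ a = π' a ∨ ψ a = π'' a := by
  obtain ⟨i, hi⟩ := exists_label_eq_of_eq hτ a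
  rcases hcells i with hc | hc | hc
  · left
    have hm := label_mem_of_eq h i
    rw [← hc, hi] at hm
    exact hm.symm
  · right; left
    have hm := label_mem_of_eq h' i
    rw [← hc, hi] at hm
    exact hm.symm
  · right; right
    have hm := label_mem_of_eq h'' i
    rw [← hc, hi] at hm
    exact hm.symm

/-! ### (B6) Adjacency pull-back -/

/-- **Adjacency pull-back.** Under the label identity, let `σ, σ'` be perfect matchings of `H` with
images `π, π'` (`e_φ(σ) = m_π`, `e_φ(σ') = m_{π'}`). If `π⁻¹ π'` is a single cycle (the symmetric
difference of `π, π'` is one alternating circuit), then so is `σ⁻¹ σ'`. Proof: otherwise switching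
`σ` along ONE cycle `c` of `σ⁻¹ σ'` gives a third perfect matching `σ c` of `H`; every cell of its
image is a cell of `π` or `π'` (`image_apply_mem₂`), so the image is `π` or `π'`
(`eq_one_or_eq_of_isCycle`), contradicting injectivity of the label-bijection. [folklore] -/
theorem isCycle_inv_mul_of_labelIdentity {H E : Finset (Fin n × Fin n)}
    {φ : Fin n × Fin n → Fin n × Fin n}
    (hid : (∑ σ : Equiv.Perm (Fin n), if (∀ i, (i, σ i) ∈ H) then
        ∏ i, (X (φ (i, σ i)) : MvPolynomial (Fin n × Fin n) ℂ) else 0) =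
      perfectMatchingPoly E ℂ)
    {σ σ' π π' : Perm (Fin n)} (hσ : ∀ i, (i, σ i) ∈ H) (hσ' : ∀ i, (i, σ' i) ∈ H)
    (h : (∑ i, Finsupp.single (φ (i, σ i)) 1 : (Fin n × Fin n) →₀ ℕ) = matchingExponent π)
    (h' : (∑ i, Finsupp.single (φ (i, σ' i)) 1 : (Fin n × Fin n) →₀ ℕ) = matchingExponent π')
    (hcyc : (π⁻¹ * π').IsCycle) : (σ⁻¹ * σ').IsCycle := by
  classical
  set θ := σ⁻¹ * σ' with hθ
  -- `σ ≠ σ'` since `π ≠ π'`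
  have hne : σ ≠ σ' := by
    rintro rfl
    have hππ : π = π' := matchingExponent_injective (h.symm.trans h')
    rw [hππ, inv_mul_cancel] at hcyc
    exact Perm.IsCycle.ne_one hcyc rfl
  obtain ⟨x, hx⟩ : ∃ x, θ x ≠ x := by
    by_contra hall
    push Not at hall
    apply hne
    have : θ = 1 := Equiv.ext fun a => by simpa using hall a
    rw [hθ, inv_mul_eq_one] at this
    exact this
  by_contra hnot
  -- one cycle `c` of `θ`, a proper part of `θ`
  set c := θ.cycleOf x with hc
  have hccyc : c.IsCycle := Perm.isCycle_cycleOf θ hx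
  have hcθ : c ≠ θ := fun e => hnot (e ▸ hccyc)
  have hc1 : c ≠ 1 := Perm.IsCycle.ne_one hccyc
  -- the switched matching `τ = σ c`
  set τ := σ * c with hτ
  have hτcells : ∀ i, τ i = σ i ∨ τ i = σ' i := by
    intro i
    rw [hτ, Perm.mul_apply, hc, Perm.cycleOf_apply]
    split_ifs
    · right
      rw [hθ, Perm.mul_apply, perm_apply_inv_self]
    · left; rfl
  have hτH : ∀ i, (i, τ i) ∈ H := fun i => by
    rcases hτcells i with e | e <;> rw [e]
    exacts [hσ i, hσ' i]
  have hτσ : τ ≠ σ := by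
    intro e
    apply hc1
    rw [hτ] at e
    exact mul_left_cancel (e.trans (mul_one σ).symm)
  have hτσ' : τ ≠ σ' := by
    intro e
    apply hcθ
    rw [hθ, ← e, inv_mul_cancel_left]
  -- its image lies inside the cells of `π, π'`, hence is `π` or `π'`
  obtain ⟨ψ, -, hψ⟩ := exists_perm_of_labelIdentity hid hτH
  have hψcells : ∀ a, (π⁻¹ * ψ) a = a ∨ (π⁻¹ * ψ) a = (π⁻¹ * π') a := by
    intro a
    rcases image_apply_mem₂ hψ h h' hτcells a with e | e
    · left
      rw [Perm.mul_apply, e, perm_inv_apply_self]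
    · right
      rw [Perm.mul_apply, Perm.mul_apply, e]
  rcases eq_one_or_eq_of_isCycle hcyc hψcells with e | e
  · -- `ψ = π`: then `τ = σ`
    have hψπ : ψ = π := by
      have := congrArg (fun g => π * g) e
      simpa using this
    rw [hψπ, ← h] at hψ
    exact hτσ (labelExponent_injective_of_labelIdentity hid hτH hσ hψ)
  · -- `ψ = π'`: then `τ = σ'`
    have hψπ : ψ = π' := by
      have := congrArg (fun g => π * g) e
      simpa using this
    rw [hψπ, ← h'] at hψ
    exact hτσ' (labelExponent_injective_of_labelIdentity hid hτH hσ' hψ)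

/-! ### (B1) `H` and `E` have equally many perfect matchings -/

/-- **The label-bijection is a bijection**: under the label identity, `H` and `E` have the same
number of perfect matchings (`σ ↦ π` with `e_φ(σ) = m_π`; `exists_perm_of_labelIdentity`,
`labelExponent_injective_of_labelIdentity`, `exists_preimage_of_labelIdentity`,
`matchingExponent_injective`). [folklore] -/
theorem card_filter_isPerfectMatching_eq {H E : Finset (Fin n × Fin n)}
    {φ : Fin n × Fin n → Fin n × Fin n}
    (hid : (∑ σ : Equiv.Perm (Fin n), if (∀ i, (i, σ i) ∈ H) then
        ∏ i, (X (φ (i, σ i)) : MvPolynomial (Fin n × Fin n) ℂ) else 0) =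
      perfectMatchingPoly E ℂ) :
    (Finset.univ.filter fun σ : Perm (Fin n) => ∀ i, (i, σ i) ∈ H).card =
      (Finset.univ.filter fun π : Perm (Fin n) => ∀ i, (i, π i) ∈ E).card := by
  classical
  refine Finset.card_bij
    (fun σ hσ => Classical.choose (exists_perm_of_labelIdentity hid (Finset.mem_filter.1 hσ).2))
    (fun σ hσ => Finset.mem_filter.2 ⟨Finset.mem_univ _,
      (Classical.choose_spec (exists_perm_of_labelIdentity hid (Finset.mem_filter.1 hσ).2)).1⟩)
    (fun σ₁ hσ₁ σ₂ hσ₂ heq => ?_) (fun π hπ => ?_)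
  · have h₁ := (Classical.choose_spec (exists_perm_of_labelIdentity hid (Finset.mem_filter.1 hσ₁).2)).2
    have h₂ := (Classical.choose_spec (exists_perm_of_labelIdentity hid (Finset.mem_filter.1 hσ₂).2)).2
    rw [heq] at h₁
    exact labelExponent_injective_of_labelIdentity hid (Finset.mem_filter.1 hσ₁).2
      (Finset.mem_filter.1 hσ₂).2 (h₁.trans h₂.symm)
  · obtain ⟨σ, hσ, hσπ⟩ := exists_preimage_of_labelIdentity hid (Finset.mem_filter.1 hπ).2
    refine ⟨σ, Finset.mem_filter.2 ⟨Finset.mem_univ _, hσ⟩, ?_⟩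
    have h₁ := (Classical.choose_spec (exists_perm_of_labelIdentity hid hσ)).2
    exact matchingExponent_injective (h₁.symm.trans hσπ)

end Summit.ValiantsHypothesis.PolyaContinued
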